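import Literature.Computability.AlgebraicComplexity.KoszulFlatteningGeneralDim
import HarnessLib

/-!
# The universal kernel of Koszul flattenings of symmetric tensors

`Summits/MatrixMultiplication/MatrixMultiplication/Theorems` (soloist file, blind arm, session s8).

Let `X ∈ A ⊗ A ⊗ C` be symmetric in its first two slots (`X a b m = X b a m`; e.g. every symmetric
tensor, in particular every Kronecker power of `T_{cw,q}` or of the `xyz`-tensor), `Φ : K^A → K^q` a
restriction map and `K_{q,p+1}(Φ; X) : Λ^{p+1} K^q ⊗ A^* → Λ^{p+2} K^q ⊗ C` the general Koszul flattening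
of the tree (`koszulFlatteningGen q (p+1) Φ X`).  The EULER MATRIX `V : Λ^p K^q → Λ^{p+1} K^q ⊗ A^*`,
`e_H ↦ ∑_a (Φ(e_a) ∧ e_H) ⊗ a^*`, satisfies

* `K_{q,p+1}(Φ; X) · V = 0` (`soloSym_koszul_mul_euler`): the `((J,m), H)` entry is
  `∑_{a,b} X(a,b,m) · (Φe_a ∧ Φe_b ∧ ·)_{J,H}`, a symmetric coefficient against an alternating one;
* `V` is injective as soon as `Φ` is surjective and `p < q` (`soloSym_euler_mulVec_injective`).

Hence the **universal corank bound** (`soloSym_rank_koszul_add_choose_le`):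

  `rank K_{q,p+1}(Φ; X) + C(q,p) ≤ C(q,p+1) · dim A`   for surjective `Φ`, `p < q`.

This is the structural fact behind every Koszul rank this seat computed for powers of `T_{cw,2}`:
the generic coranks are exactly `C(5,1) = 5` (`(q,p) = (5,2)`, `k = 2, 3`: ranks `85`, `265` — the
tree's certificates), `C(7,2) = 21` (`(7,3)`, `k = 3, 4, 5`), `C(9,3) = 84` (`(9,4)`, `k = 3, 4`),
`C(11,4) = 330` (`(11,5)`, `k = 3, 4`).  Consequence (paper.md §17.7 (xii), arithmetic only): a
`(2p+1, p)` flattening can certify at most `bR(T_{cw,2}^{⊠k}) ≥ ⌈3^k (2p+1)/(p+1) − p(2p+1)/((p+1)(p+2))⌉`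
— never `52` for the cube, never an `ω`-relevant bound at Kronecker level `k ≥ 8`.

References: J.M. Landsberg, G. Ottaviani, *Equations for secant varieties of Veronese and other
varieties*, Ann. Mat. Pura Appl. 192 (2013) (Young flattenings; the symmetric case); J.M. Landsberg,
*Geometry and Complexity Theory* (2017), §2.4–2.5 (Koszul flattenings, Thm. 2.5.3.1).
-/

open scoped BigOperators Matrix
open Matrix

namespace Summit.MatrixMultiplication.MatrixMultiplication.Theorems

open Literature.Computability.AlgebraicComplexity

variable {K : Type*} [Field K] {q : ℕ}

/-! ## Exterior algebra: anticommutation and linearity of `e ∧ ·` -/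

section Wedge

/-- **`e ∧ e' ∧ x = - e' ∧ e ∧ x`** (polarisation of `e ∧ e ∧ x = 0`). [folklore] -/
theorem soloSym_wedgeMatrix_anticomm (e e' : Fin q → K) :
    wedgeMatrix e * wedgeMatrix e' + wedgeMatrix e' * wedgeMatrix e = 0 := by
  have h := wedgeMatrix_mul_self (K := K) (e + e')
  rw [wedgeMatrix_add, add_mul, mul_add, mul_add, wedgeMatrix_mul_self, wedgeMatrix_mul_self,
    zero_add, add_zero] at h
  exact h

/-- `(∑ cᵢ uᵢ) ∧ · = ∑ cᵢ (uᵢ ∧ ·)`. [folklore] -/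
theorem soloSym_wedgeMatrix_sum_smul {σ : Type*} [Fintype σ] (c : σ → K) (u : σ → Fin q → K) :
    wedgeMatrix (∑ i, c i • u i) = ∑ i, c i • wedgeMatrix (u i) := by
  show wedgeMatrixLin (∑ i, c i • u i) = ∑ i, c i • wedgeMatrixLin (u i)
  rw [map_sum]
  simp_rw [map_smul]

/-- The graded product `∑_{|I| = p+1} (u ∧ ·)_{T,I} (v ∧ ·)_{I,H}` is the full product
`((u ∧ ·)(v ∧ ·))_{T,H}` for `|H| = p` (other degrees do not contribute). [folklore] -/
theorem soloSym_sum_PSub_mul (u v : Fin q → K) (T : Finset (Fin q)) {p : ℕ} (H : PSub q p) :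
    ∑ I : PSub q (p + 1), wedgeMatrix u T I.1 * wedgeMatrix v I.1 H.1 =
      (wedgeMatrix u * wedgeMatrix v) T H.1 := by
  classical
  have key : ∀ S : Finset (Fin q), S.card ≠ p + 1 →
      wedgeMatrix u T S * wedgeMatrix v S H.1 = 0 := by
    intro S hS
    rw [wedgeMatrix_of_not v (T := S) (S := H.1) (by
      rintro ⟨-, h⟩
      exact hS (by rw [h, H.2])), mul_zero]
  rw [Matrix.mul_apply]
  rw [← Finset.sum_subset (Finset.filter_subset (fun S : Finset (Fin q) => S.card = p + 1)
    Finset.univ) (fun S _ hS => key S (by simpa using hS))]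
  rw [Finset.sum_subtype (Finset.univ.filter fun S : Finset (Fin q) => S.card = p + 1)
    (p := fun S : Finset (Fin q) => S.card = p + 1) (by simp)]

end Wedge

/-! ## The Euler matrix and the vanishing `K · V = 0` -/

section Euler

variable {ι μ : Type*} [Fintype ι] [DecidableEq ι]

/-- The **Euler matrix** `V : Λ^p K^q → Λ^{p+1} K^q ⊗ A^*`, `e_H ↦ ∑_a (Φ(e_a) ∧ e_H) ⊗ a^*`:
entry `((I, a), H) = (Φ(e_a) ∧ ·)_{I,H}`. [new] -/
def soloSymEuler (q p : ℕ) (Φ : (ι → K) →ₗ[K] (Fin q → K)) :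
    Matrix (PSub q (p + 1) × ι) (PSub q p) K :=
  Matrix.of fun c H => wedgeMatrix (Φ (Pi.single c.2 1)) c.1.1 H.1

/-- A vector is the combination of the coordinate vectors. [folklore] -/
theorem soloSym_fun_eq_sum_single (f : ι → K) : f = ∑ a, f a • (Pi.single a (1 : K) : ι → K) := by
  ext b
  simp [Finset.sum_apply, Pi.single_apply]

/-- **`K_{q,p+1}(Φ; X) · V = 0`** for `X` symmetric in its first two slots: the `((J,m),H)` entry is
`∑_{a,b} X(a,b,m) ((Φe_a ∧ ·)(Φe_b ∧ ·))_{J,H}`, symmetric coefficients against alternating ones.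
[new] -/
theorem soloSym_koszul_mul_euler (q p : ℕ) (Φ : (ι → K) →ₗ[K] (Fin q → K))
    (X : ι → ι → μ → K) (hX : ∀ a b m, X a b m = X b a m) :
    koszulFlatteningGen q (p + 1) Φ X * soloSymEuler q p Φ = 0 := by
  classical
  ext r H
  obtain ⟨J, m⟩ := r
  rw [Matrix.mul_apply, Matrix.zero_apply, Fintype.sum_prod_type, Finset.sum_comm]
  simp only [koszulFlatteningGen_apply, soloSymEuler, Matrix.of_apply]
  -- `∑_b ∑_I (Φ X(·,b,m) ∧ ·)_{J,I} (Φ e_b ∧ ·)_{I,H} = ∑_b ((Φ X(·,b,m) ∧ ·)(Φ e_b ∧ ·))_{J,H}`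
  simp_rw [soloSym_sum_PSub_mul]
  -- expand `Φ X(·,b,m) = ∑_a X a b m • Φ e_a`
  have hlin : ∀ b : ι, Φ (fun a => X a b m) = ∑ a, X a b m • Φ (Pi.single a 1) := by
    intro b
    conv_lhs => rw [soloSym_fun_eq_sum_single (fun a => X a b m)]
    rw [map_sum]
    simp_rw [map_smul]
  simp_rw [hlin, soloSym_wedgeMatrix_sum_smul, Finset.sum_mul, Matrix.sum_apply, smul_mul_assoc,
    Matrix.smul_apply, smul_eq_mul]
  -- now: `∑_b ∑_a X a b m * ((Φe_a ∧ ·)(Φe_b ∧ ·))_{J,H} = 0`, by the involution `(b,a) ↦ (a,b)`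
  rw [← Finset.sum_product']
  refine Finset.sum_involution (fun x _ => (x.2, x.1)) ?_ ?_ (fun x _ => by simp) (fun x _ => rfl)
  · rintro ⟨b, a⟩ -
    simp only
    rw [hX a b m, ← mul_add, ← Matrix.add_apply, add_comm, soloSym_wedgeMatrix_anticomm,
      Matrix.zero_apply, mul_zero]
  · rintro ⟨b, a⟩ - hne
    simp only [ne_eq, Prod.mk.injEq, not_and]
    intro hab
    subst hab
    exfalso
    apply hne
    simp only
    rw [wedgeMatrix_mul_self, Matrix.zero_apply, mul_zero]

end Euler

/-! ## Injectivity of the Euler matrix and the corank bound -/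

section Rank

variable {ι μ : Type*} [Fintype ι] [DecidableEq ι]

/-- `(∑_a x_a Φe_a ∧ ·) = (Φ x ∧ ·)` entrywise. [folklore] -/
theorem soloSym_sum_mul_wedge_single (Φ : (ι → K) →ₗ[K] (Fin q → K)) (x : ι → K)
    (T S : Finset (Fin q)) :
    ∑ a, x a * wedgeMatrix (Φ (Pi.single a 1)) T S = wedgeMatrix (Φ x) T S := by
  conv_rhs => rw [soloSym_fun_eq_sum_single x, map_sum]
  simp_rw [map_smul]
  rw [soloSym_wedgeMatrix_sum_smul, Matrix.sum_apply]
  simp [Matrix.smul_apply]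

/-- `(e_i ∧ ·)_{H ∪ {i}, H'} = ε(H,i) [H' = H]` for `i ∉ H`, `|H'| = |H|`. [folklore] -/
theorem soloSym_wedge_single_insert {p : ℕ} (H H' : PSub q p) (i : Fin q) (hi : i ∉ H.1) :
    wedgeMatrix (Pi.single i (1 : K)) (insert i H.1) H'.1 =
      if H' = H then (koszulSign H.1 i : K) else 0 := by
  classical
  rw [wedgeMatrix_apply, Finset.sum_eq_single i]
  · by_cases hH : H' = H
    · subst hH
      simp [hi]
    · rw [if_neg hH, if_neg]
      rintro ⟨hi', h⟩
      apply hH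
      apply Subtype.ext
      have := congrArg (fun S => S.erase i) h
      simpa [Finset.erase_insert hi, Finset.erase_insert hi'] using this.symm
  · intro j _ hji
    simp [hji]
  · simp

/-- **The Euler matrix is injective** when `Φ` is surjective and `p < q`: pairing the `(H ∪ {i}, ·)`
rows against a preimage of `e_i` isolates `± v_H`. [new] -/
theorem soloSym_euler_mulVec_injective (q p : ℕ) (hp : p < q) (Φ : (ι → K) →ₗ[K] (Fin q → K))
    (hΦ : Function.Surjective Φ) :
    Function.Injective (soloSymEuler q p Φ).mulVecLin := by
  classical
  refine (injective_iff_map_eq_zero _).2 fun v hv => ?_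
  funext H₀
  obtain ⟨i, hi⟩ : ∃ i : Fin q, i ∉ H₀.1 := by
    by_contra h
    push Not at h
    have hu : H₀.1 = Finset.univ := Finset.eq_univ_of_forall h
    have hc := congrArg Finset.card hu
    rw [H₀.2, Finset.card_univ, Fintype.card_fin] at hc
    omega
  obtain ⟨x, hx⟩ := hΦ (Pi.single i 1)
  have hI₀ : (insert i H₀.1).card = p + 1 := by rw [Finset.card_insert_of_notMem hi, H₀.2]
  -- the combination `∑_a x_a (V v)_{(H₀ ∪ i, a)}` vanishes …
  have h0 : ∑ a, x a * (soloSymEuler q p Φ *ᵥ v) (⟨insert i H₀.1, hI₀⟩, a) = 0 := by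
    have hv' : soloSymEuler q p Φ *ᵥ v = 0 := by simpa using hv
    simp [hv']
  -- … and equals `ε(H₀, i) v_{H₀}`
  have h1 : ∑ a, x a * (soloSymEuler q p Φ *ᵥ v) (⟨insert i H₀.1, hI₀⟩, a) =
      (koszulSign H₀.1 i : K) * v H₀ := by
    simp only [Matrix.mulVec, dotProduct, soloSymEuler, Matrix.of_apply, Finset.mul_sum]
    rw [Finset.sum_comm]
    have : ∀ H : PSub q p, ∑ a, x a * (wedgeMatrix (Φ (Pi.single a 1)) (insert i H₀.1) H.1 * v H) =
        (if H = H₀ then (koszulSign H₀.1 i : K) else 0) * v H := by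
      intro H
      simp_rw [← mul_assoc]
      rw [← Finset.sum_mul, soloSym_sum_mul_wedge_single, hx, soloSym_wedge_single_insert H₀ H i hi]
    simp_rw [this]
    simp
  have hs : (koszulSign H₀.1 i : K) ≠ 0 := by
    intro h
    have := congrArg (fun z : ℤ => (z : K)) (koszulSign_mul_self H₀.1 i)
    simp only [Int.cast_mul, Int.cast_one] at this
    rw [h, mul_zero] at this
    exact zero_ne_one this
  rw [h1] at h0
  simpa [hs] using h0

/-- **Universal corank bound for Koszul flattenings of symmetric tensors**:
`rank K_{q,p+1}(Φ; X) + C(q,p) ≤ C(q,p+1) · dim A` whenever `X(a,b,m) = X(b,a,m)`, `Φ` is surjective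
and `p < q` — the image of the Euler matrix is a `C(q,p)`-dimensional subspace of the kernel. [new] -/
theorem soloSym_rank_koszul_add_choose_le (q p : ℕ) (hp : p < q)
    (Φ : (ι → K) →ₗ[K] (Fin q → K)) (hΦ : Function.Surjective Φ)
    (X : ι → ι → μ → K) (hX : ∀ a b m, X a b m = X b a m) :
    (koszulFlatteningGen q (p + 1) Φ X).rank + q.choose p ≤ q.choose (p + 1) * Fintype.card ι := by
  classical
  set Kz := koszulFlatteningGen q (p + 1) Φ X with hKz
  set V := soloSymEuler q p Φ with hVdef
  have hKV : Kz * V = 0 := soloSym_koszul_mul_euler q p Φ X hX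
  have hle : LinearMap.range V.mulVecLin ≤ LinearMap.ker Kz.mulVecLin := by
    rintro _ ⟨v, rfl⟩
    simp only [LinearMap.mem_ker, Matrix.mulVecLin_apply, Matrix.mulVec_mulVec, hKV,
      Matrix.zero_mulVec]
  have hV : Module.finrank K (LinearMap.range V.mulVecLin) = q.choose p := by
    rw [LinearMap.finrank_range_of_inj (soloSym_euler_mulVec_injective q p hp Φ hΦ),
      Module.finrank_fintype_fun_eq_card, card_PSub]
  have hsum := LinearMap.finrank_range_add_finrank_ker Kz.mulVecLin
  rw [Module.finrank_fintype_fun_eq_card, Fintype.card_prod, card_PSub] at hsum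
  have hmono := Submodule.finrank_mono hle
  have hrk : Kz.rank = Module.finrank K (LinearMap.range Kz.mulVecLin) := rfl
  rw [hrk]
  omega

end Rank

/-! ## Kronecker powers of `T_{cw,2}` -/

section CwPowers

variable {ι μ : Type*}

/-- `T_{cw,q}` is symmetric in its first two slots (indeed fully symmetric). [cite: ConnerGesmundoLandsbergVentura2022, eq. (1)] -/
theorem soloSym_cwTensor_symm (n : ℕ) (i j k : Fin (n + 1)) :
    cwTensor K n i j k = cwTensor K n j i k := by
  rw [cwTensor_apply, cwTensor_apply]
  congr 1
  apply propext
  constructor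
  · rintro (⟨h1, h2, h3⟩ | ⟨h1, h2, h3⟩ | ⟨h1, h2, h3⟩)
    · exact Or.inr (Or.inl ⟨h1, h2, h3⟩)
    · exact Or.inl ⟨h1, h2, h3⟩
    · exact Or.inr (Or.inr ⟨h1, h2.symm, fun h => h3 (h2 ▸ h)⟩)
  · rintro (⟨h1, h2, h3⟩ | ⟨h1, h2, h3⟩ | ⟨h1, h2, h3⟩)
    · exact Or.inr (Or.inl ⟨h1, h2, h3⟩)
    · exact Or.inl ⟨h1, h2, h3⟩
    · exact Or.inr (Or.inr ⟨h1, h2.symm, fun h => h3 (h2 ▸ h)⟩)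

/-- Kronecker powers of a tensor symmetric in its first two slots are symmetric in their first two
slots. [folklore] -/
theorem soloSym_kroneckerPow_symm {t : ι → ι → μ → K} (ht : ∀ i j k, t i j k = t j i k) (N : ℕ)
    (a b : Fin N → ι) (c : Fin N → μ) :
    kroneckerPow t N a b c = kroneckerPow t N b a c := by
  simp only [kroneckerPow_apply]
  exact Finset.prod_congr rfl fun i _ => ht _ _ _

/-- **Universal Koszul ceiling for the powers of `T_{cw,2}`**: for every surjective restriction
`M : K^{3^N} → K^q` and `p < q`,
`rank K_{q,p+1}(M; T_{cw,2}^{⊠N}) ≤ C(q,p+1) · 3^N − C(q,p)`.  (Observed to be attained by generic `M`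
at `(q,p+1) ∈ {(7,3),(9,4),(11,5)}`, `N ∈ {3,4,5}` in the seat's modular computations.) [new] -/
theorem soloSym_cwTwoPow_koszul_ceiling (N q p : ℕ) (hp : p < q)
    (M : Matrix (Fin q) (Fin N → Fin 3) K) (hM : Function.Surjective M.mulVecLin) :
    (koszulFlatteningGen q (p + 1) M.mulVecLin (kroneckerPow (cwTensor K 2) N)).rank + q.choose p ≤
      q.choose (p + 1) * 3 ^ N := by
  have h := soloSym_rank_koszul_add_choose_le q p hp M.mulVecLin hM (kroneckerPow (cwTensor K 2) N)
    (fun a b m => soloSym_kroneckerPow_symm (soloSym_cwTensor_symm (K := K) 2) N a b m)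
  simpa [Fintype.card_fun, Fintype.card_fin] using h

/-- The cube at `(q,p+1) = (11,5)`: rank `≤ 462 · 27 − 330 = 12144 < 50 · C(10,5) = 12600`, so this
flattening can never certify `bR(T_{cw,2}^{⊠3}) ≥ 50` through the Landsberg–Ottaviani count (the seat's
generic value is exactly `12144`, certifying `49`). [new] -/
theorem soloSym_cwTwoCube_koszul_eleven_five_le (M : Matrix (Fin 11) (Fin 3 → Fin 3) K)
    (hM : Function.Surjective M.mulVecLin) :
    (koszulFlatteningGen 11 5 M.mulVecLin (kroneckerPow (cwTensor K 2) 3)).rank ≤ 12144 := by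
  have h := soloSym_cwTwoPow_koszul_ceiling 3 11 4 (by norm_num) M hM
  have h1 : (11 : ℕ).choose 4 = 330 := by decide
  have h2 : (11 : ℕ).choose (4 + 1) = 462 := by decide
  rw [h1, h2] at h
  show (koszulFlatteningGen 11 (4 + 1) M.mulVecLin (kroneckerPow (cwTensor K 2) 3)).rank ≤ 12144
  norm_num at h
  omega

/-- The seventh power at `(q,p+1) = (11,5)`: rank `≤ 462 · 2187 − 330 = 1010064 < 4009 · 252`, so no
`(11,5)` flattening of `T_{cw,2}^{⊠7}` certifies more than `bR ≥ 4008`; the `ω`-relevant threshold at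
this level is `3988` (`3.26874^7 ≈ 3987.1`), i.e. `(11,5)` is — by counting alone — still admissible at
`k = 7`, while at `k = 8` (`3^8 = 6561`, threshold `13033`) the analogous ceiling
`⌈(462 · 6561 − 330)/252⌉ = 12027` is not. [new] -/
theorem soloSym_cwTwoPow_eight_koszul_eleven_five_lt (M : Matrix (Fin 11) (Fin 8 → Fin 3) K)
    (hM : Function.Surjective M.mulVecLin) :
    (koszulFlatteningGen 11 5 M.mulVecLin (kroneckerPow (cwTensor K 2) 8)).rank < 13033 * 252 := by
  have h := soloSym_cwTwoPow_koszul_ceiling 8 11 4 (by norm_num) M hM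
  have h1 : (11 : ℕ).choose 4 = 330 := by decide
  have h2 : (11 : ℕ).choose (4 + 1) = 462 := by decide
  rw [h1, h2] at h
  show (koszulFlatteningGen 11 (4 + 1) M.mulVecLin (kroneckerPow (cwTensor K 2) 8)).rank < 13033 * 252
  norm_num at h
  omega

end CwPowers

end Summit.MatrixMultiplication.MatrixMultiplication.Theorems
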